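import Summits.Ventures.PercRepro.SevenThreeBookkeeping
import Summits.Ventures.PercRepro.SevenThreePlane

/-!
# PercRepro — the `(7,3)` cell: the bridge between the frame's `hP₁` and the reduced world's `supply` (p3, gen 15)

The frame (`SevenThreePlane.lean`) takes Theorem P₁(7,3) in the tree's shape: for a plane `G`, a triple `T ∈ U_G` and an
independent `7`-set `W ⊆ E ∖ G`, the witnesses `S` with `S ∩ G = T`, `S ∖ G ⊆ W` supply `Σ f(G, S)/D(S) ≥ 28/5`. The
bookkeeping (`SevenThreeBookkeeping.lean`) states P₁(7,3) as `28/5 ≤ supply M T W` on a `ReducedWorld M T W`. This file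
identifies the two: such `(G, T, W)` is a reduced world (`reducedWorld_of_plane`), and the map `X ↦ T ∪ X` is a bijection
from the witnesses `X ⊆ W` onto the witness family of `T` with `f(G, T ∪ X) = 1` (`supply_eq_sum_filter`) — so the
frame's hypothesis follows from `supply_ge_phi` (`hP1_of_supply`), and `rls_seven_three_of_supply` closes the cell modulo
`supply_ge_phi` and the positive-type planes.
-/

namespace PercRepro

namespace SevenThree

open Finset ThmH SixThree PerFlat

variable {α : Type*} [DecidableEq α] {M : Matroid α} [M.Finite]

/-- A plane `G`, a triple `T ∈ U_G` and an independent `7`-set `W ⊆ E ∖ G` form a reduced world. -/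
theorem reducedWorld_of_plane (hs : Simple M) {G T W : Finset α} (hG : G ∈ planes M) (hT : T ∈ UqG M 7 3 G)
    (hT3 : T.card = 3) (hW : W ⊆ gr M \ G) (hWind : M.Indep (W : Set α)) (hW7 : W.card = 7) :
    ReducedWorld M T W := by
  obtain ⟨⟨hTg, hrT, -⟩, hTG⟩ := mem_UqG_seven_three.1 hT
  have hWg : W ⊆ gr M := hW.trans Finset.sdiff_subset
  have hWG : ∀ w ∈ W, w ∉ G := fun w hw => (Finset.mem_sdiff.1 (hW hw)).2
  refine ⟨hs, hTg, hT3, hrT, hWg, hWind, hW7, ?_, ?_⟩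
  · rw [Finset.disjoint_left]
    intro t ht hw
    exact hWG t hw (hTG ht)
  · intro w hw hcl
    have hclG : M.closure (T : Set α) = (G : Set α) := closure_eq_of_subset_plane hG hTG hrT
    rw [hclG] at hcl
    exact hWG w hw (Finset.mem_coe.1 hcl)

/-- `f(G, T ∪ X) = 1` for `X ⊆ W ⊆ E ∖ G` and `T ⊆ G` a rank-`3` triple, and `(T ∪ X) ∩ G = T`. -/
theorem fRule_union_eq_one {G T W X : Finset α} (hTG : T ⊆ G) (hrT : M.eRk (T : Set α) = 3) (hT3 : T.card = 3)
    (hW : W ⊆ gr M \ G) (hX : X ⊆ W) : (T ∪ X) ∩ G = T ∧ fRule M G (T ∪ X) = 1 := by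
  have hinter : (T ∪ X) ∩ G = T := by
    ext e
    simp only [Finset.mem_inter, Finset.mem_union]
    constructor
    · rintro ⟨heT | heX, heG⟩
      · exact heT
      · exact absurd heG (Finset.mem_sdiff.1 (hW (hX heX))).2
    · intro heT
      exact ⟨Or.inl heT, hTG heT⟩
  refine ⟨hinter, ?_⟩
  rw [fRule_eq_of_inter hinter hrT, hT3]
  norm_num

/-- **The supply of `T` from `W` is the frame's witness sum**: `supply M T W = Σ_{S ∈ Y(7,3), S ∩ G = T, S ∖ G ⊆ W} f(G,S)/D(S)`. -/
theorem supply_eq_sum_filter {G T W : Finset α} (hTg : T ⊆ gr M) (hTG : T ⊆ G) (hrT : M.eRk (T : Set α) = 3)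
    (hT3 : T.card = 3) (hW : W ⊆ gr M \ G) :
    supply M T W = ∑ S ∈ (Yq M 7 3).filter (fun S => S ∩ G = T ∧ S \ G ⊆ W), fRule M G S / D M S := by
  classical
  unfold supply
  have hWg : W ⊆ gr M := hW.trans Finset.sdiff_subset
  refine Finset.sum_nbij' (fun X => T ∪ X) (fun S => S \ G) ?_ ?_ ?_ ?_ ?_
  · -- `T ∪ X` is in the witness family
    intro X hX
    rw [Finset.mem_filter, Finset.mem_powerset] at hX
    obtain ⟨hXW, hw⟩ := hX
    obtain ⟨hinter, -⟩ := fRule_union_eq_one hTG hrT hT3 hW hXW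
    rw [Finset.mem_filter, mem_Yq_seven_three]
    refine ⟨⟨Finset.union_subset hTg (hXW.trans hWg), hw.1, hw.2⟩, hinter, ?_⟩
    intro e he
    rw [Finset.mem_sdiff, Finset.mem_union] at he
    rcases he.1 with heT | heX
    · exact absurd (hTG heT) he.2
    · exact hXW heX
  · -- `S ∖ G` is a witness subset of `W`
    intro S hS
    rw [Finset.mem_filter, mem_Yq_seven_three] at hS
    obtain ⟨⟨-, h3, h7⟩, hSG, hSW⟩ := hS
    rw [Finset.mem_filter, Finset.mem_powerset]
    refine ⟨hSW, ?_⟩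
    have hS' : T ∪ S \ G = S := by
      ext e
      simp only [Finset.mem_union, Finset.mem_sdiff]
      constructor
      · rintro (heT | ⟨heS, -⟩)
        · rw [← hSG] at heT; exact (Finset.mem_inter.1 heT).1
        · exact heS
      · intro heS
        by_cases heG : e ∈ G
        · left; rw [← hSG]; exact Finset.mem_inter.2 ⟨heS, heG⟩
        · right; exact ⟨heS, heG⟩
    unfold IsWitness
    rw [hS']
    exact ⟨h3, h7⟩
  · -- left inverse: `(T ∪ X) ∖ G = X`
    intro X hX
    rw [Finset.mem_filter, Finset.mem_powerset] at hX
    ext e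
    simp only [Finset.mem_sdiff, Finset.mem_union]
    constructor
    · rintro ⟨heT | heX, heG⟩
      · exact absurd (hTG heT) heG
      · exact heX
    · intro heX
      exact ⟨Or.inr heX, (Finset.mem_sdiff.1 (hW (hX.1 heX))).2⟩
  · -- right inverse: `T ∪ (S ∖ G) = S`
    intro S hS
    rw [Finset.mem_filter] at hS
    obtain ⟨-, hSG, -⟩ := hS
    ext e
    simp only [Finset.mem_union, Finset.mem_sdiff]
    constructor
    · rintro (heT | ⟨heS, -⟩)
      · rw [← hSG] at heT; exact (Finset.mem_inter.1 heT).1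
      · exact heS
    · intro heS
      by_cases heG : e ∈ G
      · left; rw [← hSG]; exact Finset.mem_inter.2 ⟨heS, heG⟩
      · right; exact ⟨heS, heG⟩
  · -- the values: `f(G, T ∪ X) = 1`
    intro X hX
    rw [Finset.mem_filter, Finset.mem_powerset] at hX
    obtain ⟨-, hf⟩ := fRule_union_eq_one hTG hrT hT3 hW hX.1
    rw [hf]

/-- **The frame's `hP₁` from the bookkeeping form of P₁(7,3)**. -/
theorem hP1_of_supply (hs : Simple M) (hsup : ∀ T W : Finset α, ReducedWorld M T W → (28 / 5 : ℚ) ≤ supply M T W)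
    {G : Finset α} (hG : G ∈ planes M) :
    ∀ T ∈ UqG M 7 3 G, T.card = 3 → ∀ W ⊆ gr M \ G, M.Indep (W : Set α) → W.card = 7 →
      (28 / 5 : ℚ) ≤ ∑ S ∈ (Yq M 7 3).filter (fun S => S ∩ G = T ∧ S \ G ⊆ W), fRule M G S / D M S := by
  intro T hT hT3 W hW hWind hW7
  obtain ⟨⟨hTg, hrT, -⟩, hTG⟩ := mem_UqG_seven_three.1 hT
  rw [← supply_eq_sum_filter hTg hTG hrT hT3 hW]
  exact hsup T W (reducedWorld_of_plane hs hG hT hT3 hW hWind hW7)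

/-- **The `(7,3)` cell modulo its two open statements**: `ThmN.RLS M 7 3` for a simple matroid of rank `7` from
`supply_ge_phi` (P₁(7,3) on every reduced world) and the per-plane inequality on the positive-type planes. -/
theorem rls_seven_three_of_supply {α : Type} [DecidableEq α] {M : Matroid α} [M.Finite] (hs : Simple M)
    (hrank : M.eRank = 7)
    (hsup : ∀ T W : Finset α, ReducedWorld M T W → (28 / 5 : ℚ) ≤ supply M T W)
    (hpos : ∀ G ∈ planes M, M.eRk ((gr M \ G : Finset α) : Set α) < 7 →
      (28 / 5 : ℚ) * ((UqG M 7 3 G).card : ℚ) ≤ ∑ S ∈ Yq M 7 3, fRule M G S / D M S) :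
    ThmN.RLS M 7 3 :=
  rls_seven_three_of_P1 hs hrank (fun _ hG => hP1_of_supply hs hsup hG) hpos

end SevenThree

end PercRepro
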